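/-
Copyright (c) 2026 the pub-hodgecm-mathlib formalisation cell (harness21).  Prover seat hodgecm-mathlib-LH4-p19 (g3), req620 Track A «(D-RAM) FOUR-FRAME» squad
(STAGE-1b, row (2) of the piece `f_{T₊}`, the (β₂) road (R-36) «PURE-CELL LEDGER»; β₂ WORD #29∕#31 «p19: RAY BANDS» — the socket letters of an upper-line RAY cell at the
level of ONE cell member `(Λ, x₀)`), 2026-09-05.
-/
import Summits.HodgeConjecture.HodgeConjecture.Theorems.F0P3cDyRamUpperRayVertexReads          -- this seat (R1a): per-vertex reads; brings ★ p864080, F2, F3, ★ p863048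
import Summits.HodgeConjecture.HodgeConjecture.Theorems.F0P3cDyRamRowCellSocketReads             -- ★ p863914 (LH4-p16 (g2)): `exists_coord_of_gen`, `exists_indexTwo_letters`; brings ★ p863859, ★ `exists_map_eq_glueUnit`
import Summits.HodgeConjecture.HodgeConjecture.Theorems.F0P3cDyRamConeCellGluedVertexExistsOfWeight  -- ★ p864081 (LH7-p10 (g3)): `exists_glued_of_mem_levelSetDep_of_weight_ne_zero`
import Summits.HodgeConjecture.HodgeConjecture.Theorems.F0P3cDyRamConeCellPresentation            -- ★ p862869 (LH7-p09 (g2)): `exists_presentation_of_mem_levelSetDep`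
import HarnessLib

/-!
# Crux `H413`, line LH4 «(D-RAM) FOUR-FRAME» — STAGE-1b, row (2), the (β₂) road (R-36), (OFF) residue, RAY bands: «THE SOCKET LETTERS OF AN UPPER-LINE RAY CELL, MEMBER BY
# MEMBER» — the vertex frame of a cell member (glue scalar `pw`, coordinate `V`), its DEPTH DIGIT and its two POPULATION reads (class and sign), for ★ p864098

Cell `hodgecm-mathlib` (D-0151), FLOOR 0, crux item H413 = `stmt-HodgeConjecture-24833`, route of record `HCCMUnconditional`; squad F0∕P3c∕LH4; lane
`--supports stmt-HodgeConjecture-24833 --as helper` (count-neutral; pays NO tier-0 row).  THEOREMS ONLY (no `def`, no instance, no notation, no `sorry`, default heartbeats);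
★-only imports; states NO law; (β₂) stays a HYPOTHESIS.  Frame = the OPENED letters of ‹OFF.letter.v2› that the pieces use (E-datum, the line model `(M, jE, ρ, Θ, α; φ, lam, h)`,
the literal `(H₂, h_W)`, the element `(γ₂, u)`, the weight letter `hf`) + the CELL CONSTANTS of this seat's R1 worker: the reference pair `(κ₀, ξ₀)` (★ F4 §3), the centre `W`,
the slope `B`, the fixed data `γ₁, W₁` with the SLOPE∕ROOT letters (★ F2∕F3), `P = (ϖσϖ)^b`, `t₊`.

WHY (β₂ WORD #29 «p19: RAY BANDS»).  ★ p864098 `cellDiff_eq_zero_of_fibration_reads₄` wants, member by member (`GEN Λ x₀` = the five `levelSet` clauses ∧ the depth clause):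
(hP) populatedness, the three-way reads (hL₁)(hL₂) of the two literal predicates, and — for (hLit)∕(hF) — the depth clause as a DIGIT.  THIS FILE provides them for an upper-line
RAY cell: §1 `exists_vertexFrame_of_gen` (the glue scalar `pw = ⟨w₀, w₀⟩` of ANY member: `φw₀ = Y⁻¹x₀`, `σpw = pw`, `|pw·P| = 1`, and its coordinate `V`: `D₀⁻¹(jE pw)⁻¹ = κ₀ + jE V·ξ₀`
with `jE V = (ρu₀∕t − κ₀)∕ξ₀` = ★ p863914's `Vf x₀`); §2 `depDigit_iff_of_gen` (the depth clause `↔ |γ₁(V − W₁)|·|t₊| ≤ 1`, ★ R1a HEAD 1-bis); §3 `weight_ne_zero_iff_cls_of_gen6`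
((hP) = ★ p863859 HEAD 1 with the depth clause taken from `GEN`, not from a cell identity) and `weight_ne_zero_iff_normSign_of_gen6` (★ p863859 HEAD 2 likewise: the population
SIGN `ω(⟨w₀,w₀⟩·(ϖσϖ)^b) = ω(−h_W)`).  The three-way literal reads (hL₁)(hL₂) are the sequel file `…UpperRayCellLiteralReads` (★ p862869 presentation → ★ R1a HEADS → this §3).
HONEST LABEL.  Count-neutral bookkeeping; nothing printed is asserted; no census law is stated; `hU_ray`, `hD_ray`, `hL_ray` stay OPEN; `HC_CM` is proved only modulo the 7 printed
citations (2 remaining named inputs: hLiu418 = `stmt-HodgeConjecture-24832`, h413 = `stmt-HodgeConjecture-24833`) until rung 0 closes.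
## References
* [Kottwitz1986BaseChangeUnits] R. E. Kottwitz, *Base change for unit elements of Hecke algebras*, Compositio Math. 60 (1986): §1 pp. 240–241, §3.
* [Jacobowitz1962] R. Jacobowitz, *Hermitian forms over local fields*, Amer. J. Math. 84 (1962): §4.
* [Rogawski1990] J. D. Rogawski, *Automorphic Representations of Unitary Groups in Three Variables*, Ann. of Math. Stud. 123 (1990): §4.9 Prop. 4.9.1 (b) p. 55, §12.2.
* [Serre1979] J.-P. Serre, *Local Fields*, GTM 67 (1979): Ch. III §6 Prop. 12; Ch. V §3 Cor. 3; Ch. XV §2.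
* [LabesseLanglands1979] J.-P. Labesse, R. P. Langlands, *L-indistinguishability for SL(2)*, Canad. J. Math. 31 (1979): §2 (2.2) p. 9.
-/

set_option autoImplicit false

noncomputable section

namespace Summit.HodgeConjecture.HodgeConjecture.Cruxes.H413.F0P3cDyRamUpperRayCellReads

open scoped Valued WithZero Matrix MatrixGroups
open WithZero
open Literature.NumberTheory.Automorphic Literature.NumberTheory.Automorphic.HermitianLattice Literature.NumberTheory.Automorphic.UnitaryLatticeTree
open Literature.NumberTheory.Automorphic.UnitaryThreeFourFrame (IsRamifiedQuadraticDatum normSign)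
open Literature.NumberTheory.Rogawski1990
open Summit.HodgeConjecture.HodgeConjecture.Cruxes.H413.F0P3cDyRamFourFramePieces
open Summit.HodgeConjecture.HodgeConjecture.Cruxes.H413.F0P3cDyRamFourFrameCensusDefs (LatticeInLevel)
open Summit.HodgeConjecture.HodgeConjecture.Cruxes.H413.F0P3cDyRamToricCensusDefs
open Summit.HodgeConjecture.HodgeConjecture.Cruxes.H413.F0P3cDyRamDiagonalCellLetter (inv_add_map_inv_eq_map_pairing)
open Summit.HodgeConjecture.HodgeConjecture.Cruxes.H413.F0P3cDyRamRowCellSocketReads (exists_coord_of_gen)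
open Summit.HodgeConjecture.HodgeConjecture.Cruxes.H413.F0P3cDyRamRowCellFibreTransport (trace_letters)
open Summit.HodgeConjecture.HodgeConjecture.Cruxes.H413.F0P3cDyRamUpperRayVertexReads (isOrd_div_iff_ball exactLevel_iff_sphere valueSet_eq_xPlus_iff_sphereSign)

variable {E M : Type} [Field E] [Valued E ℤᵐ⁰] [Field M] [Valued M ℤᵐ⁰] {ρ Θ : M →+* M} {α : M}

/-! ## §1 The vertex frame of a cell member: glue scalar and coordinate -/

/-- **THE VERTEX FRAME OF A CELL MEMBER.**  E-datum; `jE`-letters (`|jE a| = |a|`, `Fix ρ = jE(E)`, `Θ∘jE = jE∘σ`); `ρ, Θ` commuting involutive isometries; `Θh = h ≠ 0`; the form letter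
`hform` for `(H₂, φ)` with `H₂` hermitian and `φ` onto; the cell `(j, b)`, `1 ≤ b`, `cc(α − ρα) ≠ 0`, `hFgap`; a reference pair `κ₀, ξ₀ ∈ Fix Θ` (`Tr_ρ κ₀ = 1`, `ρξ₀ = −ξ₀ ≠ 0`,
`|κ₀| ≤ |ξ₀|`, `|ϖE|^b ≤ |ξ₀|·|cc(α − ρα)|`) and a member `(Λ, x₀)` with the five `GEN` clauses.  THEN there are `w₀` and a fixed integral `V ∈ E` with: `φ w₀ = Y⁻¹x₀`,
`jE V = (ρu₀∕t − κ₀)∕ξ₀` (★ p863914's `Vf x₀`; `u₀ = h·x₀Θx₀`, `t = Tr_ρ u₀`), `D₀⁻¹·(jE⟨w₀, w₀⟩)⁻¹ = κ₀ + jE V·ξ₀` (★ p862871's shape), `σ⟨w₀, w₀⟩ = ⟨w₀, w₀⟩` and `|⟨w₀, w₀⟩·(ϖσϖ)^b| = 1`.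
[cite: Jacobowitz1962, §4] [cite: Kottwitz1986BaseChangeUnits, §1 pp. 240–241] [cite: Serre1979, Ch. III §6 Prop. 12] -/
theorem exists_vertexFrame_of_gen {σ : E →+* E} {ϖ : E} {d tE : ℕ} (hD : IsRamifiedQuadraticDatum σ ϖ d tE)
    (jE : E →+* M) (hjiso : ∀ a, Valued.v (jE a) = Valued.v a) (hjfix : ∀ z, ρ z = z ↔ ∃ c, jE c = z) (hΘj : ∀ c, Θ (jE c) = jE (σ c))
    (hρρ : ∀ x, ρ (ρ x) = x) (hvρ : ∀ x, Valued.v (ρ x) = Valued.v x) (hΘΘ : ∀ x, Θ (Θ x) = x) (hΘρ : ∀ x, Θ (ρ x) = ρ (Θ x)) (hvΘ : ∀ x, Valued.v (Θ x) = Valued.v x)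
    {hM : M} (hΘh : Θ hM = hM) (hh : hM ≠ 0)
    {H₂ : Matrix (Fin 2) (Fin 2) E} (hH₂σ : (H₂.map σ)ᵀ = H₂) (φ : (Fin 2 → E) →+ M) (hφo : Function.Surjective φ)
    (hform : ∀ x y, jE (pairing σ H₂ x y) = hM * Θ (φ x) * φ y + ρ (hM * Θ (φ x) * φ y))
    {j b : ℕ} (hb1 : 1 ≤ b) (hcc : jE ϖ ^ j * (α - ρ α) ≠ 0)
    (hFgap : ∀ z : M, ρ z = z → Θ z = z → Valued.v (jE ϖ) < Valued.v z → Valued.v z ≤ 1 → Valued.v z = 1)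
    {κ₀ ξ₀ : M} (hκ₀ : κ₀ + ρ κ₀ = 1) (hΘκ₀ : Θ κ₀ = κ₀) (hξ : ρ ξ₀ = -ξ₀) (hΘξ : Θ ξ₀ = ξ₀) (hξ0 : ξ₀ ≠ 0)
    (hκ₀v : Valued.v κ₀ ≤ Valued.v ξ₀) (hR : Valued.v (jE ϖ) ^ b ≤ Valued.v ξ₀ * Valued.v (jE ϖ ^ j * (α - ρ α)))
    (Λ : AddSubgroup M) (x₀ : M)
    (hG : x₀ ≠ 0 ∧ (∀ x, x ∈ Λ ↔ ∃ ζ, IsOrd ρ α (jE ϖ ^ j) ζ ∧ x = x₀ * ζ) ∧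
      IsOrd ρ α (jE ϖ ^ j) (dualGen ρ Θ α (jE ϖ ^ j) hM x₀) ∧ ¬ IsOrd ρ α (jE ϖ ^ j) (dualGen ρ Θ α (jE ϖ ^ j) hM x₀ / jE ϖ) ∧
      Valued.v (dualGen ρ Θ α (jE ϖ ^ j) hM x₀) = Valued.v (jE ϖ) ^ b) :
    ∃ (w₀ : Fin 2 → E) (V : E), φ w₀ = (dualGen ρ Θ α (jE ϖ ^ j) hM x₀)⁻¹ * x₀ ∧ σ V = V ∧ Valued.v V ≤ 1 ∧
      jE V = (ρ (hM * (x₀ * Θ x₀)) / (hM * (x₀ * Θ x₀) + ρ (hM * (x₀ * Θ x₀))) - κ₀) / ξ₀ ∧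
      (jE ϖ ^ j * (α - ρ α) * Θ (dualGen ρ Θ α (jE ϖ ^ j) hM x₀))⁻¹ * (jE (pairing σ H₂ w₀ w₀))⁻¹ = κ₀ + jE V * ξ₀ ∧
      σ (pairing σ H₂ w₀ w₀) = pairing σ H₂ w₀ w₀ ∧ Valued.v (pairing σ H₂ w₀ w₀ * (ϖ * σ ϖ) ^ b) = 1 := by
  obtain ⟨hσσ, hvσ, hϖ, -, -, -, -⟩ := id hD
  have hvϖ0 : Valued.v ϖ ≠ 0 := by rw [hϖ]; exact exp_ne_zero
  have hϖ0 : ϖ ≠ 0 := fun h0 => hvϖ0 (by rw [h0, map_zero])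
  have hϖ1 : Valued.v ϖ ≤ 1 := by rw [hϖ, ← exp_zero, exp_le_exp]; norm_num
  have hjϖ0 : jE ϖ ≠ 0 := (map_ne_zero jE).2 hϖ0
  have hjϖ1 : Valued.v (jE ϖ) ≤ 1 := by rw [hjiso]; exact hϖ1
  have hjv : ∀ c, Valued.v (jE c) ≤ 1 ↔ Valued.v c ≤ 1 := fun c => by rw [hjiso]
  have hρj : ∀ c : E, ρ (jE c) = jE c := fun c => (hjfix _).2 ⟨c, rfl⟩
  have hρϖ : ρ (jE ϖ) = jE ϖ := hρj ϖ
  have hc : ρ (jE ϖ ^ j) = jE ϖ ^ j := by rw [map_pow, hρϖ]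
  obtain ⟨hx₀, hΛx, hyO, hyprim, hylev⟩ := hG
  set Y : M := dualGen ρ Θ α (jE ϖ ^ j) hM x₀ with hYdef
  set u₀ : M := hM * (x₀ * Θ x₀) with hu₀def
  set t : M := u₀ + ρ u₀ with htdef
  -- the dual vertex generator `w₀` and the glue letter
  obtain ⟨w₀, hw₀Y⟩ := hφo (Y⁻¹ * x₀)
  set D₀ : M := jE ϖ ^ j * (α - ρ α) * Θ Y with hD₀def
  have hTr : D₀⁻¹ + ρ D₀⁻¹ = jE (pairing σ H₂ w₀ w₀) := inv_add_map_inv_eq_map_pairing σ H₂ jE hΘΘ φ hh hform hcc hx₀ hw₀Y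
  -- the coordinate (★ p863914)
  obtain ⟨V, hjV, hσV, hV1⟩ := exists_coord_of_gen (α := α) hD jE hjv hjfix hΘj hρρ hvρ hΘΘ hΘρ hΘh hb1 hcc hFgap hκ₀ hΘκ₀ hξ hΘξ hξ0 hκ₀v hR Λ x₀
    ⟨hx₀, hΛx, hyO, hyprim, hylev⟩
  -- `t` is a doubly-fixed unit; `u₀ ≠ 0`
  obtain ⟨hρt, -, ht1⟩ := trace_letters (α := α) hρρ hΘΘ hΘρ hΘh hρϖ hjϖ0 hjϖ1 hb1 hcc hFgap hyO hyprim hylev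
  have ht1' : Valued.v t = 1 := by rw [htdef, hu₀def]; exact ht1
  have ht0 : t ≠ 0 := fun h0 => by rw [h0, map_zero] at ht1'; exact zero_ne_one ht1'
  have hu₀0 : u₀ ≠ 0 := mul_ne_zero hh (mul_ne_zero hx₀ ((map_ne_zero Θ).2 hx₀))
  have hρu₀0 : ρ u₀ ≠ 0 := (map_ne_zero ρ).2 hu₀0
  -- `D₀ = u₀·ν` with `ν` `ρ`-fixed, so `D₀⁻¹∕(D₀⁻¹ + ρD₀⁻¹) = ρu₀∕t`
  set ν : M := jE ϖ ^ j * (α - ρ α) * (Θ (jE ϖ ^ j) * Θ (α - ρ α)) with hνdef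
  have hν0 : ν ≠ 0 := mul_ne_zero hcc (by rw [← map_mul]; exact (map_ne_zero Θ).2 hcc)
  have hD₀ν : D₀ = u₀ * ν := by
    rw [hD₀def, hYdef, dualGen_def, hu₀def, hνdef]; simp only [map_mul, hΘΘ, hΘh]; ring
  have hρν : ρ ν = ν := by
    rw [hνdef]; simp only [map_mul, map_sub, hρρ, hc, ← hΘρ]; ring
  have hκform : D₀⁻¹ * (jE (pairing σ H₂ w₀ w₀))⁻¹ = ρ u₀ / t := by
    rw [← hTr, hD₀ν, map_inv₀, map_mul, hρν, htdef]
    field_simp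
    ring
  have hκ : D₀⁻¹ * (jE (pairing σ H₂ w₀ w₀))⁻¹ = κ₀ + jE V * ξ₀ := by
    rw [hκform, hjV, div_mul_cancel₀ _ hξ0]; ring
  -- `σ pw = pw` (hermitian symmetry) and `|pw·P| = 1`
  have hH₂h : ∀ a c : Fin 2, σ (H₂ a c) = H₂ c a := fun a c => by
    have e := congrFun (congrFun hH₂σ c) a
    rwa [Matrix.transpose_apply, Matrix.map_apply] at e
  have hσpw : σ (pairing σ H₂ w₀ w₀) = pairing σ H₂ w₀ w₀ := (pairing_comm_of_hermitian hσσ hH₂h w₀ w₀).symm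
  have hpw0 : jE (pairing σ H₂ w₀ w₀) ≠ 0 := fun h0 => by
    have := hκform
    rw [h0, inv_zero, mul_zero] at this
    exact div_ne_zero hρu₀0 ht0 this.symm
  have hpwv : Valued.v (jE (pairing σ H₂ w₀ w₀)) = (Valued.v (jE ϖ) ^ (2 * b))⁻¹ := by
    -- `|D₀| = |cc(α − ρα)|·|Y|`, `|ρu₀∕t| = |u₀| = |Y|∕|cc(α − ρα)|`
    have hvD : Valued.v D₀ = Valued.v (jE ϖ ^ j * (α - ρ α)) * Valued.v (jE ϖ) ^ b := by
      rw [hD₀def, Valuation.map_mul, hvΘ, hylev]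
    have hYu : Y = u₀ * (jE ϖ ^ j * (α - ρ α)) := by rw [hYdef, dualGen_def]
    have hvκ : Valued.v (ρ u₀ / t) * Valued.v (jE ϖ ^ j * (α - ρ α)) = Valued.v (jE ϖ) ^ b := by
      rw [map_div₀, hvρ, ht1', div_one, ← Valuation.map_mul, ← hYu, hylev]
    have hD₀0 : D₀ ≠ 0 := by rw [hD₀ν]; exact mul_ne_zero hu₀0 hν0
    have e : D₀ * (ρ u₀ / t) * jE (pairing σ H₂ w₀ w₀) = 1 := by
      rw [← hκform]; field_simp
    have hprod : Valued.v D₀ * Valued.v (ρ u₀ / t) = Valued.v (jE ϖ) ^ (2 * b) := by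
      rw [hvD, mul_right_comm, mul_comm (Valued.v (jE ϖ ^ j * (α - ρ α))), hvκ, ← pow_add, ← two_mul]
    have hv := congrArg Valued.v e
    rw [Valuation.map_mul, Valuation.map_mul, Valuation.map_one, hprod] at hv
    exact eq_inv_of_mul_eq_one_right hv
  refine ⟨w₀, V, hw₀Y, hσV, hV1, hjV, hκ, hσpw, ?_⟩
  have hvP : Valued.v ((ϖ * σ ϖ) ^ b) = Valued.v ϖ ^ (2 * b) := by
    rw [Valuation.map_pow, Valuation.map_mul, hvσ, ← pow_two, ← pow_mul]
  rw [Valuation.map_mul, ← hjiso (pairing σ H₂ w₀ w₀), hpwv, hjiso, hvP, inv_mul_cancel₀ (pow_ne_zero _ hvϖ0)]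

/-! ## §2 The depth digit and the population reads of a member -/

/-- **THE DEPTH CLAUSE OF A MEMBER IS THE BALL DIGIT OF ITS COORDINATE.**  Frame of §1 (through any `w₀, V` it returns: `φ w₀ = Y⁻¹x₀`, the `κ`-form, `|⟨w₀,w₀⟩·P| = 1`) + the
cell's centre `W`, slope `B`, fixed `γ₁, W₁` with the strict SLOPE letter and the ROOT letter in ball form, `ρμ ≠ μ`, `|μ| ≤ |Y|`.  THEN the depth clause of ★ DEFS `levelSetDep`
at `Λ` holds iff `|γ₁(V − W₁)|·|t₊| ≤ 1` (★ DEFS `forall_herm_mul_mem_iff_isOrd_div` ∘ ★ R1a `isOrd_div_iff_ball`). [cite: Kottwitz1986BaseChangeUnits, §1 pp. 240–241] [cite: Jacobowitz1962, §4] -/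
theorem dep_iff_ball {σ : E →+* E} {ϖ : E} {d tE : ℕ} (hD : IsRamifiedQuadraticDatum σ ϖ d tE)
    (jE : E →+* M) (hjv : ∀ c, Valued.v (jE c) ≤ 1 ↔ Valued.v c ≤ 1) (hjfix : ∀ z, ρ z = z ↔ ∃ c, jE c = z)
    (hρρ : ∀ x, ρ (ρ x) = x) (hvρ : ∀ x, Valued.v (ρ x) = Valued.v x) (hα : ρ α ≠ α) (hα1 : Valued.v α ≤ 1)
    (hint : ∀ z : M, Valued.v z ≤ 1 → Valued.v ((z - ρ z) / (α - ρ α)) ≤ 1)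
    (hΘΘ : ∀ x, Θ (Θ x) = x) (hΘρ : ∀ x, Θ (ρ x) = ρ (Θ x)) (hvΘ : ∀ x, Valued.v (Θ x) = Valued.v x)
    {hM : M} (hΘh : Θ hM = hM) (hh : hM ≠ 0) (H₂ : Matrix (Fin 2) (Fin 2) E) (φ : (Fin 2 → E) →+ M)
    (hform : ∀ x y, jE (pairing σ H₂ x y) = hM * Θ (φ x) * φ y + ρ (hM * Θ (φ x) * φ y))
    {j b : ℕ} (hcc : jE ϖ ^ j * (α - ρ α) ≠ 0) {μ : M} (hμρ : ρ μ ≠ μ) (hμY : Valued.v μ ≤ Valued.v (jE ϖ) ^ b)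
    (Λ : AddSubgroup M) (x₀ : M)
    (hG : x₀ ≠ 0 ∧ (∀ x, x ∈ Λ ↔ ∃ ζ, IsOrd ρ α (jE ϖ ^ j) ζ ∧ x = x₀ * ζ) ∧
      IsOrd ρ α (jE ϖ ^ j) (dualGen ρ Θ α (jE ϖ ^ j) hM x₀) ∧ ¬ IsOrd ρ α (jE ϖ ^ j) (dualGen ρ Θ α (jE ϖ ^ j) hM x₀ / jE ϖ) ∧
      Valued.v (dualGen ρ Θ α (jE ϖ ^ j) hM x₀) = Valued.v (jE ϖ) ^ b)
    {w₀ : Fin 2 → E} (hw₀Y : φ w₀ = (dualGen ρ Θ α (jE ϖ ^ j) hM x₀)⁻¹ * x₀)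
    {κ₀ ξ₀ : M} {V W BE P γ₁ W₁ : E}
    (hκ : (jE ϖ ^ j * (α - ρ α) * Θ (dualGen ρ Θ α (jE ϖ ^ j) hM x₀))⁻¹ * (jE (pairing σ H₂ w₀ w₀))⁻¹ = κ₀ + jE V * ξ₀)
    (hW : jE W * ξ₀ = ρ μ / (ρ μ - μ) - κ₀) (hBE : jE BE = (μ - ρ μ) * ξ₀)
    (hP0 : P ≠ 0) (hpwP : Valued.v (pairing σ H₂ w₀ w₀ * P) = 1)
    (hθ : Valued.v (BE / (P * ((ϖ - σ ϖ) * ((ϖ * σ ϖ) ^ ((d - d % 2) / 2))⁻¹)) - γ₁) < Valued.v γ₁)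
    (hWWt : Valued.v (γ₁ * (W - W₁)) * Valued.v ((ϖ - σ ϖ) * ((ϖ * σ ϖ) ^ ((d - d % 2) / 2))⁻¹) ≤ 1) :
    (∀ b', (∀ x ∈ Λ, Valued.v (hM * Θ x * b' + ρ (hM * Θ x * b')) ≤ 1) → μ * b' ∈ Λ) ↔
      Valued.v (γ₁ * (V - W₁)) * Valued.v ((ϖ - σ ϖ) * ((ϖ * σ ϖ) ^ ((d - d % 2) / 2))⁻¹) ≤ 1 := by
  obtain ⟨hσσ, hvσ, hϖ, -, hd, -, -⟩ := id hD
  have hvϖ0 : Valued.v ϖ ≠ 0 := by rw [hϖ]; exact exp_ne_zero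
  have hϖ0 : ϖ ≠ 0 := fun h0 => hvϖ0 (by rw [h0, map_zero])
  have hϖ1 : Valued.v ϖ ≤ 1 := by rw [hϖ, ← exp_zero, exp_le_exp]; norm_num
  have hjϖ0 : jE ϖ ≠ 0 := (map_ne_zero jE).2 hϖ0
  have hρj : ∀ c : E, ρ (jE c) = jE c := fun c => (hjfix _).2 ⟨c, rfl⟩
  have hc : ρ (jE ϖ ^ j) = jE ϖ ^ j := by rw [map_pow, hρj]
  have hc0 : jE ϖ ^ j ≠ 0 := pow_ne_zero _ hjϖ0
  have hc1 : Valued.v (jE ϖ ^ j) ≤ 1 := by rw [Valuation.map_pow]; exact pow_le_one₀ zero_le ((hjv ϖ).2 hϖ1)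
  obtain ⟨hx₀, hΛx, -, -, hylev⟩ := hG
  have hY0 : dualGen ρ Θ α (jE ϖ ^ j) hM x₀ ≠ 0 := fun h0 => by
    rw [h0, Valuation.map_zero] at hylev; exact pow_ne_zero _ ((Valuation.ne_zero_iff _).2 hjϖ0) hylev.symm
  rw [forall_herm_mul_mem_iff_isOrd_div hρρ hvρ hα hα1 hint hΘΘ hΘρ hvΘ hc hc0 hc1 hh hx₀ hΛx μ]
  exact isOrd_div_iff_ball (α := α) hρρ hΘΘ hΘρ hvΘ hvσ hϖ hd jE hjv hjfix H₂ φ hΘh hh hform hcc hx₀ hY0 hw₀Y hμρ (by rw [hylev]; exact hμY) hκ hW hBE hP0 hpwP hθ hWWt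

/-- **THE POPULATION READ OF A SIX-CLAUSE MEMBER** (★ p863859 HEAD 1, the depth clause supplied by the member instead of a cell identity): `f b j Λ ≠ 0 ⟺ (t(x₀) ∈ 𝒩 ⟺ ε)`.
[cite: Kottwitz1986BaseChangeUnits, §1 pp. 240–241] [cite: Serre1979, Ch. V §3 Prop. 5, Cor. 2–3; Ch. XIV §6] [cite: LabesseLanglands1979, §2 p. 8] -/
theorem weight_ne_zero_iff_cls_of_gen6 [CompleteSpace E] [IsDiscreteValuationRing 𝒪[E]] [Finite 𝓀[E]]
    {σ : E →+* E} {ϖ : E} {d tE : ℕ} (hD : IsRamifiedQuadraticDatum σ ϖ d tE) (h2v : Valued.v (2 : E) < 1)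
    (jE : E →+* M) (hjv : ∀ c, Valued.v (jE c) ≤ 1 ↔ Valued.v c ≤ 1) (hjfix : ∀ z, ρ z = z ↔ ∃ c, jE c = z) (hΘj : ∀ c, Θ (jE c) = jE (σ c))
    (hρρ : ∀ x, ρ (ρ x) = x) (hvρ : ∀ x, Valued.v (ρ x) = Valued.v x) (hΘΘ : ∀ x, Θ (Θ x) = x) (hΘρ : ∀ x, Θ (ρ x) = ρ (Θ x))
    (hvΘ : ∀ x, Valued.v (Θ x) = Valued.v x)
    {hM : M} (hΘh : Θ hM = hM) (hh : hM ≠ 0) {j b : ℕ} (hb1 : 1 ≤ b) (hdb : d ≤ b) (hcc : jE ϖ ^ j * (α - ρ α) ≠ 0)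
    (hFgap : ∀ z : M, ρ z = z → Θ z = z → Valued.v (jE ϖ) < Valued.v z → Valued.v z ≤ 1 → Valued.v z = 1)
    {hW : E} (hσhW : σ hW = hW) (hhW1 : Valued.v (jE hW) = 1)
    {lam : M} {u : E} (hlamj : IsOrd ρ α (jE ϖ ^ j) lam) (f : ℕ → ℕ → AddSubgroup M → ℕ)
    (hf : ∀ (b j : ℕ) (Λ : AddSubgroup M) (x₀ : M) (r : E), 1 ≤ b → x₀ ≠ 0 →
      (∀ x, x ∈ Λ ↔ ∃ z, IsOrd ρ α (jE ϖ ^ j) z ∧ x = x₀ * z) →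
      IsOrd ρ α (jE ϖ ^ j) (dualGen ρ Θ α (jE ϖ ^ j) hM x₀) → ¬ IsOrd ρ α (jE ϖ ^ j) (dualGen ρ Θ α (jE ϖ ^ j) hM x₀ / jE ϖ) →
      Valued.v (dualGen ρ Θ α (jE ϖ ^ j) hM x₀) = Valued.v (jE ϖ) ^ b →
      (∀ b', (∀ x ∈ Λ, Valued.v (hM * Θ x * b' + ρ (hM * Θ x * b')) ≤ 1) → (lam - jE u) * b' ∈ Λ) →
      IsOrd ρ α (jE ϖ ^ j) lam → jE r = glueUnit ρ Θ α (jE ϖ ^ j) hM (jE ϖ) (jE hW) x₀ b →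
      f b j Λ = Nat.card {x : 𝒪[E] ⧸ 𝓂[E] ^ (2 * b) // ∃ u' : 𝒪[E], Ideal.Quotient.mk (𝓂[E] ^ (2 * b)) u' = x ∧
        Valued.v ((u' : E) * σ u' - r) ≤ Valued.v (ϖ ^ (2 * b))})
    (Λ : AddSubgroup M) (x₀ : M)
    (hG : x₀ ≠ 0 ∧ (∀ x, x ∈ Λ ↔ ∃ ζ, IsOrd ρ α (jE ϖ ^ j) ζ ∧ x = x₀ * ζ) ∧
      IsOrd ρ α (jE ϖ ^ j) (dualGen ρ Θ α (jE ϖ ^ j) hM x₀) ∧ ¬ IsOrd ρ α (jE ϖ ^ j) (dualGen ρ Θ α (jE ϖ ^ j) hM x₀ / jE ϖ) ∧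
      Valued.v (dualGen ρ Θ α (jE ϖ ^ j) hM x₀) = Valued.v (jE ϖ) ^ b ∧
      (∀ b', (∀ x ∈ Λ, Valued.v (hM * Θ x * b' + ρ (hM * Θ x * b')) ≤ 1) → (lam - jE u) * b' ∈ Λ)) :
    f b j Λ ≠ 0 ↔ ((∃ e : M, ρ e = e ∧ e * Θ e = hM * (x₀ * Θ x₀) + ρ (hM * (x₀ * Θ x₀))) ↔
      ∃ e : M, ρ e = e ∧ e * Θ e = -(hM * ρ hM * ((α - ρ α) * Θ (α - ρ α)) * jE hW)) := by
  obtain ⟨c, hρc, hΘc, hcn, hdich⟩ := F0P3cDyRamRowCellSocketReads.exists_indexTwo_letters (ρ := ρ) (Θ := Θ) hD jE hjfix hΘj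
  obtain ⟨r, hr⟩ := F0P3cDyRamConeLevelTransport.exists_map_eq_glueUnit (Θ := Θ) (α := α) jE hρρ hΘρ hjfix (jE ϖ ^ j) hM x₀ ϖ hW b
  obtain ⟨hx₀, hΛ, hyO, hyprim, hylev, hdep⟩ := hG
  have hfΛ := hf b j Λ x₀ r hb1 hx₀ hΛ hyO hyprim hylev hdep hlamj hr
  exact F0P3cDyRamRowVertexPopulationRead.weight_ne_zero_iff_class (α := α) hD h2v jE hjv hjfix hΘj hρρ hvρ hΘΘ hΘρ hvΘ hΘh hh hb1 hdb hcc hFgap hx₀ hyO hyprim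
    hylev hσhW hhW1 hr hfΛ hρc hΘc hcn hdich

/-- **THE POPULATION SIGN OF A SIX-CLAUSE MEMBER** (★ p863859 HEAD 2): with the glue scalar `pw = ⟨w₀, w₀⟩` (`φ w₀ = Y⁻¹x₀`), `f b j Λ ≠ 0 ⟺ ω(pw·(ϖσϖ)^b) = ω(−h_W)`.
[cite: Kottwitz1986BaseChangeUnits, §1 pp. 240–241] [cite: Serre1979, Ch. V §3 Cor. 3; Ch. XV §2] [cite: Rogawski1990, §4.9 Prop. 4.9.1 (b) p. 55] -/
theorem weight_ne_zero_iff_normSign_of_gen6 [CompleteSpace E] [IsDiscreteValuationRing 𝒪[E]] [Finite 𝓀[E]]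
    {σ : E →+* E} {ϖ : E} {d tE : ℕ} (hD : IsRamifiedQuadraticDatum σ ϖ d tE) (h2v : Valued.v (2 : E) < 1)
    (jE : E →+* M) (hjv : ∀ c, Valued.v (jE c) ≤ 1 ↔ Valued.v c ≤ 1) (hjfix : ∀ z, ρ z = z ↔ ∃ c, jE c = z) (hΘj : ∀ c, Θ (jE c) = jE (σ c))
    (hρρ : ∀ x, ρ (ρ x) = x) (hvρ : ∀ x, Valued.v (ρ x) = Valued.v x) (hΘΘ : ∀ x, Θ (Θ x) = x) (hΘρ : ∀ x, Θ (ρ x) = ρ (Θ x))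
    (hvΘ : ∀ x, Valued.v (Θ x) = Valued.v x)
    {hM : M} (hΘh : Θ hM = hM) (hh : hM ≠ 0) {H₂ : Matrix (Fin 2) (Fin 2) E} (φ : (Fin 2 → E) →+ M)
    (hform : ∀ x y, jE (pairing σ H₂ x y) = hM * Θ (φ x) * φ y + ρ (hM * Θ (φ x) * φ y))
    {j b : ℕ} (hb1 : 1 ≤ b) (hdb : d ≤ b) (hcc : jE ϖ ^ j * (α - ρ α) ≠ 0)
    (hFgap : ∀ z : M, ρ z = z → Θ z = z → Valued.v (jE ϖ) < Valued.v z → Valued.v z ≤ 1 → Valued.v z = 1)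
    {hW : E} (hσhW : σ hW = hW) (hhW1 : Valued.v (jE hW) = 1)
    {lam : M} {u : E} (hlamj : IsOrd ρ α (jE ϖ ^ j) lam) (f : ℕ → ℕ → AddSubgroup M → ℕ)
    (hf : ∀ (b j : ℕ) (Λ : AddSubgroup M) (x₀ : M) (r : E), 1 ≤ b → x₀ ≠ 0 →
      (∀ x, x ∈ Λ ↔ ∃ z, IsOrd ρ α (jE ϖ ^ j) z ∧ x = x₀ * z) →
      IsOrd ρ α (jE ϖ ^ j) (dualGen ρ Θ α (jE ϖ ^ j) hM x₀) → ¬ IsOrd ρ α (jE ϖ ^ j) (dualGen ρ Θ α (jE ϖ ^ j) hM x₀ / jE ϖ) →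
      Valued.v (dualGen ρ Θ α (jE ϖ ^ j) hM x₀) = Valued.v (jE ϖ) ^ b →
      (∀ b', (∀ x ∈ Λ, Valued.v (hM * Θ x * b' + ρ (hM * Θ x * b')) ≤ 1) → (lam - jE u) * b' ∈ Λ) →
      IsOrd ρ α (jE ϖ ^ j) lam → jE r = glueUnit ρ Θ α (jE ϖ ^ j) hM (jE ϖ) (jE hW) x₀ b →
      f b j Λ = Nat.card {x : 𝒪[E] ⧸ 𝓂[E] ^ (2 * b) // ∃ u' : 𝒪[E], Ideal.Quotient.mk (𝓂[E] ^ (2 * b)) u' = x ∧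
        Valued.v ((u' : E) * σ u' - r) ≤ Valued.v (ϖ ^ (2 * b))})
    (Λ : AddSubgroup M) (x₀ : M)
    (hG : x₀ ≠ 0 ∧ (∀ x, x ∈ Λ ↔ ∃ ζ, IsOrd ρ α (jE ϖ ^ j) ζ ∧ x = x₀ * ζ) ∧
      IsOrd ρ α (jE ϖ ^ j) (dualGen ρ Θ α (jE ϖ ^ j) hM x₀) ∧ ¬ IsOrd ρ α (jE ϖ ^ j) (dualGen ρ Θ α (jE ϖ ^ j) hM x₀ / jE ϖ) ∧
      Valued.v (dualGen ρ Θ α (jE ϖ ^ j) hM x₀) = Valued.v (jE ϖ) ^ b ∧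
      (∀ b', (∀ x ∈ Λ, Valued.v (hM * Θ x * b' + ρ (hM * Θ x * b')) ≤ 1) → (lam - jE u) * b' ∈ Λ))
    {w₀ : Fin 2 → E} (hw₀Y : φ w₀ = (dualGen ρ Θ α (jE ϖ ^ j) hM x₀)⁻¹ * x₀) :
    f b j Λ ≠ 0 ↔ normSign σ (pairing σ H₂ w₀ w₀ * (ϖ * σ ϖ) ^ b) = normSign σ (-hW) := by
  obtain ⟨r, hr⟩ := F0P3cDyRamConeLevelTransport.exists_map_eq_glueUnit (Θ := Θ) (α := α) jE hρρ hΘρ hjfix (jE ϖ ^ j) hM x₀ ϖ hW b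
  obtain ⟨hx₀, hΛ, hyO, hyprim, hylev, hdep⟩ := hG
  have hfΛ := hf b j Λ x₀ r hb1 hx₀ hΛ hyO hyprim hylev hdep hlamj hr
  have hTr := inv_add_map_inv_eq_map_pairing σ H₂ jE hΘΘ φ hh hform hcc hx₀ hw₀Y
  exact F0P3cDyRamRowVertexPopulationRead.weight_ne_zero_iff_normSign_pairing (α := α) hD h2v jE hjv hjfix hΘj hρρ hvρ hΘΘ hΘρ hvΘ hΘh hh hb1 hdb hcc hFgap hx₀ hyO
    hyprim hylev hσhW hhW1 hTr hr hfΛ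

end Summit.HodgeConjecture.HodgeConjecture.Cruxes.H413.F0P3cDyRamUpperRayCellReads

end
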